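import Summits.ResolutionOfSingularities.ResolutionOfSingularities.Theorems.PurelyInseparableDim4ResConeHeavyKeepStep
import Summits.ResolutionOfSingularities.ResolutionOfSingularities.Theorems.PurelyInseparableDim4ResConeHeavyLoseStepLetters
import Summits.ResolutionOfSingularities.ResolutionOfSingularities.Theorems.PurelyInseparableDim4PhiLineKeepAnyLetter
import HarnessLib
import HarnessLib.Audit.Tags

/-!
# Purely inseparable four-folds — the HEAVY KEEP STEP WITH A FROZEN CONE SET («K_set»), every prime `p`, every tame shade `d < p`
# (rung-2 frame «Φ-line with a frozen cone monomial» of the K2(p) lane; the KEEP third; cell `res-dim4-pi`)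

[OURS · counted 0 · cell `res-dim4-pi` · K2(p) lane holder res-dim4-p-12 g5, HOLDER RULINGS g5-4 (5) / g5-6 / g5-8 «FROZEN CONE LETTERS
COUNT TOWARD CRITICALITY» (res-dim4-p-11 g5's observation): owners E_set = res-dim4-p-9, **K_set = res-dim4-p-7**, L_set = res-dim4-p-2,
α/labels = res-dim4-p-11, tracker = holder; seat res-dim4-p-7 g5 over its own K_gen `heavy_keep_step` (p710511).]  Nothing here proves
any TAIL(p, d, e), K2(7), K2(p) or resolution of singularities in dimension ≥ 4 / characteristic `p` — NOT proved.  AI kernel work,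
weaker than expert review.

WHAT CHANGES relative to K_gen `heavy_keep_step` (same factorisation package, same KEEP pattern `j k ≠ h`, `b k h = 0`, same RUN-frame
interface, same composition R2 → XIV/VII/II → XV → XVI → XI/XIII): the tracked letter `u₁ = x_h` may be SUBCRITICAL.  Its cleaning
exponent is `n := p − r_k h` (`0 < r_k h`, so `0 < n < p`; `n > d` allowed) and the KEEP law is res-dim4-p-11 g5's XV-bis
`PhiLine.betaS_step_lt_of_keep_pow_of_lt` (p713099); the α-bounds — `α < 1` at the parent AND the child threshold `d·(αs′ + 1) ≤ n·d!` —
come from the letter-SET reading (K-Φ1)-T `PhiLine.mul_alphaS_le_of_isIsolated_letters` (p711809) on `T := insert h P` for a finite set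
`P` of CONE LETTERS OF THE PARENT (`∀ v ∈ resVertex (c k), v_z = 0`) with SET exponent `m`, `1 ≤ m ≤ d`, `r_k h + m ≤ p`,
`p ≤ Σ_{i ∈ T} r i + m` (a frozen cone monomial of weight `W_P` beside `h` makes `h` admissible as soon as `r_h + W_P ≥ p − d`), through
`PhiLine.mul_succ_le_mul_factorial_of_le`.  The frame facts: a cone letter `z` has no `u`-coordinates in ANY frame whose y-rows
annihilate the kernel (res-dim4-p-2 g6's `inverse_apply_eq_zero_of_cone`, `…HeavyLoseStepLetters`), so `x_z ∈ (y₁, y₂, u₁)` of the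
carried frame (§0 `algebraMap_X_mem_yu1Ideal_of_row`) and — because a cone letter is never the chart letter (the step direction lies
in the kernel and has `j k`-coordinate `1`) — of the KEEP ARRIVAL frame as well (§0 `keepArrival_row`: zeroing the `j k`-entries of the
`y`/`u₁`-rows keeps the row expansion of `e_z`, `z ≠ j k`).  Cone-ness is used AT THE PARENT ONLY; the weights of `T` persist
(`j k ∉ T`, `b k ≡ 0` on `T`).
* §1 **`heavy_keep_step_letters`** (STATE LEVEL): binders of `heavy_keep_step` with `(hn1 hnd hrn)` replaced by
  `(hm1 : 1 ≤ m) (hmd : m ≤ d) (hh0 : 0 < r_k h) (hmh : r_k h + m ≤ p)` and `(P) (hPcone) (hcrit) (hcrit₁)`; conclusion = K_gen's RUN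
  frame at `k + 1` on the same `u₁ = e_h` with `d·αs′ ≤ (m − 1)·d!`, `0 < αs′`, **`βs′ < βs`**.  `heavy_keep_step` is the instance
  `P = ∅`, `m = n ≤ d`.
* §2 **`tail_heavy_keep_step_letters`** — the CHAIN DRESS (one call per KEEP edge of a constant-shade `e_G = 2` tail; the threshold is
  read at `k` and transported to `k + 1` inside), the KEEP twin of res-dim4-p-2 g6's `tail_heavy_lose_step_letters`.
[cite: CossartJannsenSaito2020, Lemma 11.5, Lemma 12.2 (5), Lemma 13.4 (3), Def. 8.2] [cite: CossartPiltant2008, (16), Prop. 4.2]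
[cite: Hauser2010, §§F–G]  bears_on: LADDER-RESOLUTION:D157-DOOR2 (res-dim4-pi · K2(p) · rung-2 frame «Φ-line with a frozen cone
monomial» · K_set).  Supports stmt-ResolutionOfSingularities-16155 (helper).
-/

set_option linter.dupNamespace false -- mandated namespace of this single-conjunct summit

noncomputable section

namespace Summit.ResolutionOfSingularities.ResolutionOfSingularities.Theorems.PIDim4

namespace ResCone

open MvPolynomial Finset IsLocalRing
open Literature.AlgebraicGeometry.Resolution
open Literature.AlgebraicGeometry.Resolution.CentreBlowup
open Literature.AlgebraicGeometry.Resolution.Hauser2010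
open Literature.AlgebraicGeometry.Resolution.HauserPerlega2019
open Literature.AlgebraicGeometry.Resolution.WeightedOrder
open PointBlowup (direction additiveSubspace)

variable {K : Type} [Field K]

/-! ## 0. Row expansions: a letter on the `(y, u₁)`-rows of a frame, and of the KEEP arrival frame -/

section Rows

/-- **One row of the identity substitution**: if `Σ_i a_i·L_{i u} = δ_{z u}` for every `u`, then `x_z = Σ_i C(a_i)·ℓ_i`,
`ℓ_i = Σ_s C(L_{i s})·x_s` (the row `z` of `X_eq_sum_C_mul_linearForm`, for an arbitrary coefficient row `a`). [folklore] -/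
theorem X_eq_sum_C_mul_linearForm_of_row {L : Fin (2 + 2) → Fin 4 → K} {a : Fin (2 + 2) → K} {z : Fin 4}
    (ha : ∀ u, ∑ i, a i * L i u = if z = u then 1 else 0) :
    (X z : MvPolynomial (Fin 4) K) = ∑ i, C (a i) * ∑ s, C (L i s) * X s := by
  have h1 : (∑ i, C (a i) * ∑ s, C (L i s) * X s : MvPolynomial (Fin 4) K) = ∑ s, C (∑ i, a i * L i s) * X s := by
    simp_rw [Finset.mul_sum, ← mul_assoc, ← C_mul, map_sum, Finset.sum_mul]
    rw [Finset.sum_comm]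
  rw [h1]
  simp_rw [ha]
  rw [Finset.sum_eq_single z (fun s _ hsz => by rw [if_neg (Ne.symm hsz), C_0, zero_mul])
    (fun h => absurd (Finset.mem_univ z) h), if_pos rfl, C_1, one_mul]

/-- **A letter with no `u₂`-coefficient lies in `(y₁, y₂, u₁)`**: if `Σ_i a_i·L_{i u} = δ_{z u}` and `a_{u₂} = 0`, then
`x_z = Σ_{k<2} C(a_{y_k})·ℓ_{y_k} + C(a_{u₁})·ℓ_{u₁}` lies in `yu1Ideal` of the frame of `L` read in `𝒪 = K[x]_{(x)}` — the `hT` of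
`PhiLine.mul_alphaS_le_of_isIsolated_letters`. [folklore] [cite: CossartJannsenSaito2020, Def. 8.2] -/
theorem algebraMap_X_mem_yu1Ideal_of_row {L : Fin (2 + 2) → Fin 4 → K} {a : Fin (2 + 2) → K} {z : Fin 4}
    (ha : ∀ u, ∑ i, a i * L i u = if z = u then 1 else 0) (hu2 : a (u2 2) = 0) :
    algebraMap (MvPolynomial (Fin 4) K) (OriginLocalization K 4) (X z) ∈
      yu1Ideal (fun idx => algebraMap (MvPolynomial (Fin 4) K) (OriginLocalization K 4) (∑ t, C (L idx t) * X t)) := by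
  refine PhiLine.algebraMap_X_mem_yu1Ideal_of_eq_sum (fun k => a (Fin.castAdd 2 k)) (a (u1 2)) ?_
  have hX := X_eq_sum_C_mul_linearForm_of_row ha
  rw [Fin.sum_univ_add] at hX
  have h2 : (∑ k : Fin 2, C (a (Fin.natAdd 2 k)) * ∑ s, C (L (Fin.natAdd 2 k) s) * X s : MvPolynomial (Fin 4) K) =
      C (a (u1 2)) * ∑ s, C (L (u1 2) s) * X s := by
    rw [Fin.sum_univ_two]
    change C (a (u1 2)) * (∑ s, C (L (u1 2) s) * X s) + C (a (u2 2)) * (∑ s, C (L (u2 2) s) * X s) = _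
    rw [hu2, C_0, zero_mul, add_zero]
  rw [h2] at hX
  rw [hX, map_add, map_sum]
  simp only [map_mul]

/-- **The KEEP arrival frame keeps the row expansion of a letter off the chart letter.**  Let `Mr·Lr = 1` with `Lr u₂ = e_{j₀}` and
let `La` be the ARRIVAL frame off `Lr` (`La u₂ = e_{j₀}`, `La i = (Lr i).update j₀ 0` for `i ≠ u₂`).  If the row `z` of `Mr` has no
`u₂`-coefficient and `z ≠ j₀`, it is again the coefficient row of `e_z` on `La`: `Σ_i Mr_{z i}·La_{i u} = δ_{z u}`. [folklore] -/
theorem keepArrival_row {Lr La : Fin (2 + 2) → Fin 4 → K} {Mr : Fin 4 → Fin (2 + 2) → K}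
    (hMr : ∀ t u, ∑ i, Mr t i * Lr i u = if t = u then 1 else 0) {j₀ z : Fin 4}
    (hLru2 : Lr (u2 2) = Pi.single j₀ 1) (hLau2 : La (u2 2) = Pi.single j₀ 1)
    (hLai : ∀ i, i ≠ u2 2 → La i = Function.update (Lr i) j₀ 0) (hz2 : Mr z (u2 2) = 0) (hzj : z ≠ j₀) :
    ∀ u, ∑ i, Mr z i * La i u = if z = u then 1 else 0 := by
  intro u
  by_cases huj : u = j₀
  · rw [huj, if_neg hzj]
    refine Finset.sum_eq_zero fun i _ => ?_
    by_cases hi : i = u2 2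
    · rw [hi, hz2, zero_mul]
    · rw [hLai i hi, Function.update_self, mul_zero]
  · rw [← hMr z u]
    refine Finset.sum_congr rfl fun i _ => ?_
    by_cases hi : i = u2 2
    · rw [hi, hLau2, hLru2]
    · rw [hLai i hi, Function.update_of_ne huj]

end Rows

/-! ## 1. The KEEP step with a frozen cone set (state level) -/

section Keep

variable [DecidableEq K]

/-- **THE HEAVY KEEP STEP WITH A FROZEN CONE SET, ∀ (p, d, m)** (factorisations, KEEP pattern, cone set and numerology as binders).
For a prime `p`, a level `d < p`, a `Step0 p` edge `c k → c (k+1)` in chart `j k` at `b k` with the factorisation package of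
`heavy_keep_step`, a tracked boundary letter `h` with `0 < r_k h`, KEPT by the step (`j k ≠ h`, `b k h = 0`, `r_{k+1} h = r_k h`), a finite
set `P` of cone letters of `c k` and a set exponent `m` (`1 ≤ m ≤ d`, `r_k h + m ≤ p`, `p ≤ Σ_{i ∈ insert h P} r_k i + m`, and the same at
`k + 1`): a RUN frame at `k` (`u₁ = e_h`, y-rows ⟂ `resVertex (c k)`, `pts ≠ ∅`, `d! < δs`, `0 < αs` for `(G)`) yields a RUN frame at `k + 1`
(`u₁′ = e_h`, y′-rows ⟂ `resVertex (c (k+1))`, `pts′ ≠ ∅`, `d! < δs′`, `d·αs′ ≤ (m − 1)·d!`, `0 < αs′`) with **`βs′ < βs`**.  See the module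
docstring for the composition. [OURS] [cite: CossartJannsenSaito2020, Lemma 11.5, Lemma 12.2 (5), Lemma 13.4 (3)]
[cite: CossartPiltant2008, (16), Prop. 4.2] -/
theorem heavy_keep_step_letters {p d m : ℕ} [CharP K p] {c : ℕ → State K} {j : ℕ → Fin 4} {b : ℕ → Fin 4 → K} {k : ℕ}
    {h : Fin 4} {G G₁ : MvPolynomial (Fin 4) K}
    -- numerology
    (hdp : d < p) (hm1 : 1 ≤ m) (hmd : m ≤ d) (hh0 : 0 < (c k).r h) (hmh : (c k).r h + m ≤ p)
    (hpo : p < (c k).r.degree + d) (ho2 : (c k).r.degree + d < 2 * p)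
    -- the factorisation package at `k` and `k + 1` and of the step
    (hF : (c k).F = monomial (c k).r 1 * G) (hd : ordZero G = d) (hdiv : ∀ e ∈ (c k).F.support, (c k).r ≤ e)
    (hbj : b k (j k) = 0)
    (hF' : (CentreBlowup.step p Finset.univ (j k) (b k) (c k)).F =
      monomial ((((c k).r.filter fun i => b k i = 0)).update (j k) ((c k).r.degree + d - p)) 1 * G₁)
    (hF₁ : (c (k + 1)).F = monomial (c (k + 1)).r 1 * G₁) (hd₁ : ordZero G₁ = d)
    (hiso : IsIsolated p (c k).F) (hiso₁ : IsIsolated p (c (k + 1)).F)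
    (hshade : (CentreBlowup.step p Finset.univ (j k) (b k) (c k)).shade = (c k).shade)
    (he : Module.finrank K (resVertex (c k)) = 2) (he₁ : Module.finrank K (resVertex (c (k + 1))) = 2)
    -- the KEEP pattern: the tracked letter `h` is neither the chart letter nor translated
    (hjh : j k ≠ h) (hbh : b k h = 0) (hr'h : (c (k + 1)).r h = (c k).r h)
    -- the frozen cone set at the parent and the set numerology at both ends
    (P : Finset (Fin 4)) (hPcone : ∀ z ∈ P, ∀ v ∈ resVertex (c k), v z = 0)
    (hcrit : p ≤ (∑ i ∈ insert h P, (c k).r i) + m) (hcrit₁ : p ≤ (∑ i ∈ insert h P, (c (k + 1)).r i) + m)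
    -- the RUN frame at `k`
    {L : Fin (2 + 2) → Fin 4 → K} {M : Fin 4 → Fin (2 + 2) → K} (hM : ∀ t u, ∑ i, M t i * L i u = if t = u then 1 else 0)
    (hLu1 : L (u1 2) = Pi.single h 1)
    (hy : ∀ i, i ≠ u1 2 → i ≠ u2 2 → ∀ w ∈ resVertex (c k), ∑ t, L i t * w t = 0)
    (hne : (pts (fun i => algebraMap (MvPolynomial (Fin 4) K) (OriginLocalization K 4) (∑ t, C (L i t) * X t))
      (Ideal.span {algebraMap (MvPolynomial (Fin 4) K) (OriginLocalization K 4) G}) d).Nonempty)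
    (hδ : Nat.factorial d < deltaS (fun i => algebraMap (MvPolynomial (Fin 4) K) (OriginLocalization K 4) (∑ t, C (L i t) * X t))
      (Ideal.span {algebraMap (MvPolynomial (Fin 4) K) (OriginLocalization K 4) G}) d)
    (hα0 : 0 < alphaS (fun i => algebraMap (MvPolynomial (Fin 4) K) (OriginLocalization K 4) (∑ t, C (L i t) * X t))
      (Ideal.span {algebraMap (MvPolynomial (Fin 4) K) (OriginLocalization K 4) G}) d) :
    ∃ (L' : Fin (2 + 2) → Fin 4 → K) (M' : Fin 4 → Fin (2 + 2) → K),
      ((∀ t u, ∑ i, M' t i * L' i u = if t = u then 1 else 0) ∧ L' (u1 2) = Pi.single h 1 ∧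
        (∀ i, i ≠ u1 2 → i ≠ u2 2 → ∀ w ∈ resVertex (c (k + 1)), ∑ t, L' i t * w t = 0) ∧
        (pts (fun i => algebraMap (MvPolynomial (Fin 4) K) (OriginLocalization K 4) (∑ t, C (L' i t) * X t))
          (Ideal.span {algebraMap (MvPolynomial (Fin 4) K) (OriginLocalization K 4) G₁}) d).Nonempty ∧
        Nat.factorial d < deltaS (fun i => algebraMap (MvPolynomial (Fin 4) K) (OriginLocalization K 4) (∑ t, C (L' i t) * X t))
          (Ideal.span {algebraMap (MvPolynomial (Fin 4) K) (OriginLocalization K 4) G₁}) d ∧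
        d * alphaS (fun i => algebraMap (MvPolynomial (Fin 4) K) (OriginLocalization K 4) (∑ t, C (L' i t) * X t))
          (Ideal.span {algebraMap (MvPolynomial (Fin 4) K) (OriginLocalization K 4) G₁}) d ≤ (m - 1) * Nat.factorial d) ∧
      0 < alphaS (fun i => algebraMap (MvPolynomial (Fin 4) K) (OriginLocalization K 4) (∑ t, C (L' i t) * X t))
          (Ideal.span {algebraMap (MvPolynomial (Fin 4) K) (OriginLocalization K 4) G₁}) d ∧
      betaS (fun i => algebraMap (MvPolynomial (Fin 4) K) (OriginLocalization K 4) (∑ t, C (L' i t) * X t))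
          (Ideal.span {algebraMap (MvPolynomial (Fin 4) K) (OriginLocalization K 4) G₁}) d <
        betaS (fun i => algebraMap (MvPolynomial (Fin 4) K) (OriginLocalization K 4) (∑ t, C (L i t) * X t))
          (Ideal.span {algebraMap (MvPolynomial (Fin 4) K) (OriginLocalization K 4) G}) d := by
  classical
  set alg := algebraMap (MvPolynomial (Fin 4) K) (OriginLocalization K 4) with halg
  -- the cleaning exponent of `u₁ = x_h` (possibly `> d`)
  set n : ℕ := p - (c k).r h with hn
  have hrn : (c k).r h + n = p := by omega
  have hn0 : 0 < n := by omega
  have hnp : n < p := by omega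
  have hmn : m ≤ n := by omega
  have hp : p ≤ (c k).r.degree + d := hpo.le
  have hhm : h ≠ j k := fun h' => hjh h'.symm
  have hdG : (d : ℕ∞) ≤ ordZero G := hd.symm.le
  have hd' : (d : ℕ∞) ≤ ordZero G₁ := hd₁.symm.le
  have hJμ : Ideal.span {alg G} ≤ maximalIdeal (OriginLocalization K 4) ^ d :=
    PhiLine.span_singleton_algebraMap_le_maximalIdeal_pow hdG
  -- (0) (K-Φ1)-T at `c k` in the carried frame: `h` and the cone letters of `P` lie in `(y₁, y₂, u₁)`, so `α < 1`
  have hTmem : ∀ i ∈ insert h P, alg (X i) ∈ yu1Ideal (fun idx => alg (∑ t, C (L idx t) * X t)) := by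
    intro i hi
    rcases Finset.mem_insert.mp hi with hih | hiP
    · rw [hih]
      exact PhiLine.algebraMap_X_mem_yu1Ideal_of_eq (by simp only [hLu1, PhiLine.sum_C_single_mul_X]; rfl)
    · exact algebraMap_X_mem_yu1Ideal_of_row (fun u => hM i u) (inverse_apply_eq_zero_of_cone he hM hy (hPcone i hiP)).2
  have hpar := PhiLine.mul_alphaS_le_of_isIsolated_letters (p := p) (d := d) (n := m) hF hiso (insert h P) hcrit hmd
    (fun i => alg (∑ t, C (L i t) * X t)) (span_range_frame_eq_maximalIdeal L M hM) hTmem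
  have hα1 : alphaS (fun i => alg (∑ t, C (L i t) * X t)) (Ideal.span {alg G}) d < Nat.factorial d := by
    have h1 : (m - 1) * Nat.factorial d < d * Nat.factorial d :=
      Nat.mul_lt_mul_of_pos_right (by omega) (Nat.factorial_pos d)
    exact Nat.lt_of_mul_lt_mul_left (lt_of_le_of_lt hpar.2 h1)
  -- (1) the step direction lies in `resVertex (c k)`, so the y-rows kill it; cone letters are not the chart letter
  have ho : ordZero (c k).F = (((c k).r.degree + d : ℕ) : ℕ∞) := by
    rw [hF, PhiLine.ordZero_monomial_one_mul, hd, Nat.cast_add]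
  have hdir : direction (j k) (b k) ∈ resVertex (c k) :=
    direction_mem_resVertex_of_shade_eq (j k) hbj ho hdiv hpo ho2 hshade
  have hrows : ∀ i, i ≠ u1 2 → i ≠ u2 2 → ∑ t, L i t * Function.update (b k) (j k) 1 t = 0 :=
    fun i hi1 hi2 => hy i hi1 hi2 _ hdir
  have hPj : ∀ z ∈ P, z ≠ j k := by
    intro z hz hzj
    have h0 : Function.update (b k) (j k) (1 : K) z = 0 := hPcone z hz _ hdir
    rw [hzj, Function.update_self] at h0
    exact one_ne_zero h0
  -- (2) R2: re-choose `u₂ := x_{j k}`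
  obtain ⟨Lr, Mr, hMr, hLru1, hLru2, hLri, hnear, hner, hαr, hβr, hδr⟩ :=
    PhiLine.exists_keep_rechoice L M hM hLu1 (dir := Function.update (b k) (j k) 1) (Function.update_self _ _ _)
      (by rw [Function.update_of_ne hhm, hbh]) hrows hJμ hne hα0
  have hyr : ∀ i, i ≠ u1 2 → i ≠ u2 2 → ∀ w ∈ resVertex (c k), ∑ t, Lr i t * w t = 0 := by
    intro i hi1 hi2 w hw'
    rw [hLri i hi2]
    exact hy i hi1 hi2 w hw'
  obtain ⟨hArBr, hBrAr⟩ := matrix_inverses_of_leftInverse hMr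
  -- (3) the departure label `G = Ψ(y) + Q` (XIV), the weak transform in the arrival y-rows (VII), the child residual (II)
  obtain ⟨Ψ, hΨ, hΨA, Q, hQ, hGΨ⟩ := PhiLine.exists_label_of_yRows_annihilate p (d := d) hdp hF hd hArBr hBrAr he
    (fun i hi1 hi2 w hw' => by simpa only [Matrix.of_apply] using hyr i hi1 hi2 w hw')
  obtain ⟨Q', hH₀⟩ := PhiLine.chartTransform_translate_label (j := j k) hbj (fun i : Fin 2 => Lr (Fin.castAdd 2 i))
    (fun i => hnear _ (castAdd_ne_u2 i)) hΨ hQ (G := G) (by simpa only [Matrix.of_apply] using hGΨ) hdG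
  obtain ⟨R, hstep, hRmem⟩ := PhiLine.step_F_eq_monomial_mul_residual (p := p) (d := d) hF hdG hp (j k) hbj
  rw [hF', monomial_one_mul_cancel_left_iff] at hstep
  -- the exponent of `h` after the step is `r_k h = p − n`, prime to `p`; so `R̃ ∈ (x_h^n)`
  have hr'h₀ : ((((c k).r.filter fun i => b k i = 0)).update (j k) ((c k).r.degree + d - p)) h = (c k).r h := by
    rw [Finsupp.coe_update, Function.update_of_ne hhm, Finsupp.filter_apply_pos (fun i => b k i = 0) (c k).r hbh]
  have hRh : R ∈ Ideal.span {(X h : MvPolynomial (Fin 4) K) ^ n} := by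
    have h1 := hRmem h (by
      rw [hr'h₀]; intro hdvd; have := Nat.le_of_dvd (by omega) hdvd; omega)
    rwa [hr'h₀, show p - (c k).r h = n by omega] at h1
  have hε := PhiLine.constantCoeff_prod_ne_zero (b k) (fun i => (c k).r i)
  -- (4) the arrival frame; (K-Φ1)-T at the isolated CHILD read in it; XV-bis child-side KEEP law
  set La : Fin (2 + 2) → Fin 4 → K :=
    Function.update (fun i => Function.update (Lr i) (j k) 0) (u2 2) (Pi.single (j k) 1) with hLa
  have hLau2 : La (u2 2) = Pi.single (j k) 1 := by rw [hLa, Function.update_self]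
  have hLai : ∀ i, i ≠ u2 2 → La i = Function.update (Lr i) (j k) 0 := fun i hi => by
    rw [hLa, Function.update_of_ne hi]
  have hLau1 : La (u1 2) = Pi.single h 1 := by
    rw [hLai _ u1_ne_u2, hLru1, PhiLine.update_single_of_ne hhm]
  have hMa := arrival_left_inverse hMr (piv := u2 2) hLru2 hLau2 hLai
  have hTmem₁ : ∀ i ∈ insert h P, alg (X i) ∈ yu1Ideal (fun idx => alg (∑ t, C (La idx t) * X t)) := by
    intro i hi
    rcases Finset.mem_insert.mp hi with hih | hiP
    · rw [hih]
      exact PhiLine.algebraMap_X_mem_yu1Ideal_of_eq (by simp only [hLau1, PhiLine.sum_C_single_mul_X]; rfl)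
    · have hz2 := (inverse_apply_eq_zero_of_cone he hMr hyr (hPcone i hiP)).2
      exact algebraMap_X_mem_yu1Ideal_of_row (keepArrival_row hMr hLru2 hLau2 hLai hz2 (hPj i hiP)) hz2
  have hchild := PhiLine.mul_alphaS_le_of_isIsolated_letters (p := p) (d := d) (n := m) hF₁ hiso₁ (insert h P) hcrit₁ hmd
    (fun i => alg (∑ t, C (La i t) * X t)) (span_range_frame_eq_maximalIdeal La _ hMa) hTmem₁
  have hα' : d * (alphaS (fun i => alg (∑ t, C (La i t) * X t)) (Ideal.span {alg G₁}) d + 1) ≤ n * Nat.factorial d :=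
    PhiLine.mul_succ_le_mul_factorial_of_le hchild.2 hm1 hmn
  obtain ⟨hnea, hαa, hβa⟩ := PhiLine.betaS_step_lt_of_keep_pow_of_lt (p := p) (d := d) (n := n) hF hd hp hhm
    hrn hn0 hnp hbj hbh Lr La Mr _ hMr hMa hLru1 hLru2 hnear hLau2 hLai hner
    (by rw [hδr]; exact hδ) (by rw [hαr]; exact hα1) hF' hd' hchild.1 hα'
  -- (5) XVI: the arrival frame is again a label after re-adapting its y-rows along `u₁` …
  obtain ⟨hAB, hBA⟩ := matrix_inverses_of_leftInverse hMa
  have hT := PhiLine.two_le_finrank_additiveSubspace_of_resVertex hF₁ hd₁ he₁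
  have hrowsA : (fun i : Fin 2 => ∑ t, C ((Matrix.of fun (i : Fin 4) (t : Fin 4) => La i t) (Fin.castAdd 2 i) t) * X t) =
      fun i : Fin 2 => ∑ t, C (Function.update (Lr (Fin.castAdd 2 i)) (j k) 0 t) * X t := by
    funext i
    simp only [Matrix.of_apply, hLai _ (castAdd_ne_u2 i)]
  have hH₀A : PointBlowup.translate (b k) (CentreBlowup.chartTransform d Finset.univ (j k) G) =
      aeval (fun i : Fin 2 => ∑ t, C ((Matrix.of fun (i : Fin 4) (t : Fin 4) => La i t) (Fin.castAdd 2 i) t) * X t) Ψ +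
        X (j k) * Q' := by
    rw [hrowsA]; exact hH₀
  have hAu2 : (Matrix.of fun (i : Fin 4) (t : Fin 4) => La i t) (u2 2) = Pi.single (j k) 1 := by
    funext t; rw [Matrix.of_apply, hLau2]
  have hAu1 : (Matrix.of fun (i : Fin 4) (t : Fin 4) => La i t) (u1 2) = Pi.single h 1 := by
    funext t; rw [Matrix.of_apply, hLau1]
  obtain ⟨lam, A', B', hA'B', hB'A', -, hA'u1, -, hne'', hδ'', hα'', hβ''⟩ :=
    PhiLine.exists_label_readaptation_of_step_pow p (d := d) hdp hAB hBA (u := u2 2)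
      (Finset.mem_insert_of_mem (Finset.mem_singleton_self _)) hAu2 hAu1 (e := n) hn0 hstep hd' hε hRh
      hH₀A hΨ hΨA hT hnea (by simp only [Matrix.of_apply]; rw [hαa, hαr]; exact hα0)
      (by simp only [Matrix.of_apply]; rw [hαa, hαr]; exact hα1)
  simp only [Matrix.of_apply] at hα'' hβ'' hne'' hδ''
  -- … and its y-rows lie in `(resVertex (c (k+1)))^⊥` (XIII)
  have hy'' := PhiLine.yRows_annihilate_of_label p (d := d) hdp hF₁ hd₁ hA'B' hB'A' he₁ hδ''
  refine ⟨A', B', ⟨fun t u => ?_, ?_, fun i hi1 hi2 w hw' => hy'' i hi1 hi2 w hw', hne'', hδ'', ?_⟩, ?_, ?_⟩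
  · have h1 := congrFun (congrFun hB'A' t) u
    rw [Matrix.mul_apply, Matrix.one_apply] at h1
    exact h1
  · rw [hA'u1, hAu1]
  · rw [hα'']; exact hchild.2
  · rw [hα'', hαa, hαr]; exact hα0
  · rw [hβ'', ← hβr]; exact hβa

end Keep

/-! ## 2. The chain dress: one call per KEEP edge of a constant-shade `e_G = 2` tail -/

section Tail

variable {p : ℕ} [hp : Fact p.Prime] [CharP K p] [DecidableEq K]

/-- **THE HEAVY KEEP STEP WITH A FROZEN CONE SET ON THE CHAIN, ∀ (p, d, m)** (chain dress of `heavy_keep_step_letters`; the KEEP twin of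
res-dim4-p-2 g6's `tail_heavy_lose_step_letters`).  Along a witnessed isolated above-floor `Step0 p` chain with `x^{r₀} ∣ F₀`, constant
shade `d < p` and `e_G = 2` from `k₀`, at any `k ≥ k₀`: a tracked boundary letter `h` with `0 < r_k h`, KEPT by the step (`j k ≠ h`,
`b k h = 0`), a finite set `P` of cone letters of `c k` (`∀ z ∈ P, ∀ v ∈ resVertex (c k), v_z = 0`) and a set exponent `m` with
`1 ≤ m ≤ d`, `r_k h + m ≤ p`, `p ≤ Σ_{i ∈ insert h P} r_k i + m` (a frozen cone monomial beside `h` of weight `≥ p − d − r_k h`).  Then a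
RUN frame at `k` (`u₁ = e_h`, y-rows ⟂ `resVertex (c k)`, `pts ≠ ∅`, `d! < δs`, `0 < αs` for `(G_k)`, `G_k = F_k / x^{r_k}`) yields a RUN
frame at `k + 1` with the same `u₁ = e_h`, `d·αs′ ≤ (m − 1)·d!`, `0 < αs′` and **`βs′ < βs`**.  The cone letters are neither the chart
letter nor translated (the step direction lies in the kernel), so the weights of `insert h P` persist and the threshold transports to
`k + 1`; every tail fact from res-dim4-p-9 g5's `tail_factorisation` / `tail_step_factorisation` / `tail_weights_laws`. [OURS]
[cite: CossartJannsenSaito2020, Lemma 11.5, Lemma 12.2 (5), Lemma 13.4 (3)] [cite: CossartPiltant2008, (16)] -/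
theorem tail_heavy_keep_step_letters {d m : ℕ} (hdp : d < p) (hm1 : 1 ≤ m) (hmd : m ≤ d) {c : ℕ → State K} {j : ℕ → Fin 4}
    {b : ℕ → Fin 4 → K} (hc : ∀ k, IsIsolated p (c k).F ∧ Step0 p (c k) (c (k + 1))) (hw : FreeTail.IsWitnessedChain p c j b)
    (hr0 : ∀ e ∈ (c 0).F.support, (c 0).r ≤ e) (hfloor : ∀ k, ordZero (c k).F ≠ p) {k₀ : ℕ}
    (hshade : ∀ k, k₀ ≤ k → (c k).shade = ((d : ℕ) : ℕ∞))
    (he : ∀ k, k₀ ≤ k → Module.finrank K (resVertex (c k)) = 2)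
    {k : ℕ} (hk : k₀ ≤ k) {h : Fin 4} (hh0 : 0 < (c k).r h) (hjh : j k ≠ h) (hbh : b k h = 0)
    (P : Finset (Fin 4)) (hPcone : ∀ z ∈ P, ∀ v ∈ resVertex (c k), v z = 0)
    (hcrit : p ≤ (∑ i ∈ insert h P, (c k).r i) + m) (hmh : (c k).r h + m ≤ p)
    {L : Fin (2 + 2) → Fin 4 → K} {M : Fin 4 → Fin (2 + 2) → K} (hM : ∀ t u, ∑ i, M t i * L i u = if t = u then 1 else 0)
    (hLu1 : L (u1 2) = Pi.single h 1)
    (hy : ∀ i, i ≠ u1 2 → i ≠ u2 2 → ∀ w ∈ resVertex (c k), ∑ t, L i t * w t = 0)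
    (hne : (pts (fun i => algebraMap (MvPolynomial (Fin 4) K) (OriginLocalization K 4) (∑ t, C (L i t) * X t))
      (Ideal.span {algebraMap (MvPolynomial (Fin 4) K) (OriginLocalization K 4)
            ((c k).F.divMonomial (c k).r)}) d).Nonempty)
    (hδ : Nat.factorial d < deltaS (fun i => algebraMap (MvPolynomial (Fin 4) K) (OriginLocalization K 4) (∑ t, C (L i t) * X t))
      (Ideal.span {algebraMap (MvPolynomial (Fin 4) K) (OriginLocalization K 4)
            ((c k).F.divMonomial (c k).r)}) d)
    (hα0 : 0 < alphaS (fun i => algebraMap (MvPolynomial (Fin 4) K) (OriginLocalization K 4) (∑ t, C (L i t) * X t))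
      (Ideal.span {algebraMap (MvPolynomial (Fin 4) K) (OriginLocalization K 4)
            ((c k).F.divMonomial (c k).r)}) d) :
    ∃ (L' : Fin (2 + 2) → Fin 4 → K) (M' : Fin 4 → Fin (2 + 2) → K),
      ((∀ t u, ∑ i, M' t i * L' i u = if t = u then 1 else 0) ∧ L' (u1 2) = Pi.single h 1 ∧
        (∀ i, i ≠ u1 2 → i ≠ u2 2 → ∀ w ∈ resVertex (c (k + 1)), ∑ t, L' i t * w t = 0) ∧
        (pts (fun i => algebraMap (MvPolynomial (Fin 4) K) (OriginLocalization K 4) (∑ t, C (L' i t) * X t))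
          (Ideal.span {algebraMap (MvPolynomial (Fin 4) K) (OriginLocalization K 4)
            ((c (k + 1)).F.divMonomial (c (k + 1)).r)}) d).Nonempty ∧
        Nat.factorial d < deltaS (fun i => algebraMap (MvPolynomial (Fin 4) K) (OriginLocalization K 4) (∑ t, C (L' i t) * X t))
          (Ideal.span {algebraMap (MvPolynomial (Fin 4) K) (OriginLocalization K 4)
            ((c (k + 1)).F.divMonomial (c (k + 1)).r)}) d ∧
        d * alphaS (fun i => algebraMap (MvPolynomial (Fin 4) K) (OriginLocalization K 4) (∑ t, C (L' i t) * X t))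
          (Ideal.span {algebraMap (MvPolynomial (Fin 4) K) (OriginLocalization K 4)
            ((c (k + 1)).F.divMonomial (c (k + 1)).r)}) d ≤ (m - 1) * Nat.factorial d) ∧
      0 < alphaS (fun i => algebraMap (MvPolynomial (Fin 4) K) (OriginLocalization K 4) (∑ t, C (L' i t) * X t))
          (Ideal.span {algebraMap (MvPolynomial (Fin 4) K) (OriginLocalization K 4)
            ((c (k + 1)).F.divMonomial (c (k + 1)).r)}) d ∧
      betaS (fun i => algebraMap (MvPolynomial (Fin 4) K) (OriginLocalization K 4) (∑ t, C (L' i t) * X t))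
          (Ideal.span {algebraMap (MvPolynomial (Fin 4) K) (OriginLocalization K 4)
            ((c (k + 1)).F.divMonomial (c (k + 1)).r)}) d <
        betaS (fun i => algebraMap (MvPolynomial (Fin 4) K) (OriginLocalization K 4) (∑ t, C (L i t) * X t))
          (Ideal.span {algebraMap (MvPolynomial (Fin 4) K) (OriginLocalization K 4)
            ((c k).F.divMonomial (c k).r)}) d := by
  have hk1 : k₀ ≤ k + 1 := by omega
  obtain ⟨hF, hd, hpo, ho2, hdiv⟩ := tail_factorisation hc hr0 hfloor hshade hk
  obtain ⟨hF', -⟩ := tail_step_factorisation hc hw hr0 hfloor hshade hk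
  obtain ⟨hF₁, hd₁, -, -, -⟩ := tail_factorisation hc hr0 hfloor hshade hk1
  obtain ⟨-, hlaw, hbj, -, -⟩ := tail_weights_laws hc hw hr0 hfloor hshade
  have hck1 : c (k + 1) = CentreBlowup.step p Finset.univ (j k) (b k) (c k) := (hw k).2.2.2.2
  have hshade_eq : (CentreBlowup.step p Finset.univ (j k) (b k) (c k)).shade = (c k).shade := by
    rw [← hck1, hshade (k + 1) hk1, hshade k hk]
  -- the step direction lies in the kernel: the letters of `insert h P` are neither the chart letter nor translated
  have ho : ordZero (c k).F = (((c k).r.degree + d : ℕ) : ℕ∞) := by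
    rw [hF, PhiLine.ordZero_monomial_one_mul, hd, Nat.cast_add]
  have hdir : direction (j k) (b k) ∈ resVertex (c k) :=
    direction_mem_resVertex_of_shade_eq (j k) (hbj k) ho hdiv hpo ho2 hshade_eq
  have hkeep : ∀ i ∈ insert h P, j k ≠ i ∧ b k i = 0 := by
    intro i hi
    rcases Finset.mem_insert.mp hi with hih | hiP
    · rw [hih]; exact ⟨hjh, hbh⟩
    · have h0 : Function.update (b k) (j k) (1 : K) i = 0 := hPcone i hiP _ hdir
      have hji : j k ≠ i := by
        intro hji; rw [← hji, Function.update_self] at h0; exact one_ne_zero h0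
      rw [Function.update_of_ne (Ne.symm hji)] at h0
      exact ⟨hji, h0⟩
  have hr' : ∀ i ∈ insert h P, (c (k + 1)).r i = (c k).r i := by
    intro i hi
    rw [hlaw k hk, Finsupp.coe_update, Function.update_of_ne (Ne.symm (hkeep i hi).1),
      Finsupp.filter_apply_pos (fun i => b k i = 0) (c k).r (hkeep i hi).2]
  have hcrit₁ : p ≤ (∑ i ∈ insert h P, (c (k + 1)).r i) + m := by
    rw [Finset.sum_congr rfl hr']; exact hcrit
  exact heavy_keep_step_letters hdp hm1 hmd hh0 hmh hpo ho2 hF hd hdiv (hbj k) hF' hF₁ hd₁ (hc k).1 (hc (k + 1)).1 hshade_eq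
    (he k hk) (he (k + 1) hk1) hjh hbh (hr' h (Finset.mem_insert_self h P)) P hPcone hcrit hcrit₁ hM hLu1 hy hne hδ hα0

end Tail

end ResCone

end Summit.ResolutionOfSingularities.ResolutionOfSingularities.Theorems.PIDim4

end
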